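import Mathlib
import Summits.Ventures.PercRepro2.MixChordCoincidence

/-!
# The crux modulo (HALF-CHORD) on the coincidence root edges and (MIX-CHORD) on the rest
(blind cell PercRepro2, night-1 g19; proofs/NIGHT1-G19.md §3′)

`CoincidenceClass`: a root edge with one end in a weight-`1` root cluster and `o` or `b` in the
weight-`1` cluster of the other end (there `Gc (p[e ↦ 1]) = 0`, `MixChordCoincidence.lean`).
**`HCov_all_of_halfChord_of_rest`**: the crux `CovForm.HCov_all` follows from (HALF-CHORD)
`Gloc p ≥ (1 − p_e) Gloc (p[e ↦ 0])` along every coincidence root edge together with (MIX-CHORD)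
along every root edge of neither the closed nor the coincidence class — the root edges whose far
end carries none of `o`, `b`, `a₃` in its weight-`1` cluster.

Own code; standard axioms.
-/

namespace Summit.Ventures.PercRepro2

open UnionCluster CovForm

namespace Mix

open scoped Classical

section Narrowed

variable {V : Type*} {E : Type*} [Fintype E] [DecidableEq E] [Fintype V] [DecidableEq V]
  {R : Type*} [Field R] [LinearOrder R] [IsStrictOrderedRing R]

variable (p : E → R) (ends : E → Sym2 V) (o a₁ a₂ b : V) (e : E)

/-- A root edge of the coincidence class: one end in a weight-`1` root cluster, `o` or `b` in the
weight-`1` cluster of the other end. -/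
def CoincidenceClass : Prop :=
  ∃ x y, ends e = s(x, y) ∧
    (x ∈ cluster ends (Chord.oneConfig p) a₁ ∨ x ∈ cluster ends (Chord.oneConfig p) a₂) ∧
    (o ∈ cluster ends (Chord.oneConfig p) y ∨ b ∈ cluster ends (Chord.oneConfig p) y)

/-- **(MIX-CHORD) at `p` from the half-chord along the coincidence root edges and the mixed chord
along the root edges of neither the closed nor the coincidence class.** -/
theorem mixChord_of_halfChord_of_rest {p : E → R} {ends : E → Sym2 V} {o a₁ a₂ a₃ b : V}
    (hp : IsProbVec p)
    (hhalf : ∀ e ∈ Chord.rootEdges p ends a₁ a₂, CoincidenceClass p ends o a₁ a₂ b e →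
      HalfChord p ends o a₁ a₂ a₃ b e)
    (hrest : ∀ e ∈ Chord.rootEdges p ends a₁ a₂, ¬ ClosedClass p ends a₁ a₂ a₃ e →
      ¬ CoincidenceClass p ends o a₁ a₂ b e →
      p e * Gc (Function.update p e 1) ends o a₁ a₂ a₃ b +
        (1 - p e) * (shrink p ends a₁ a₂ a₃ e * Gc (Function.update p e 0) ends o a₁ a₂ a₃ b) ≤
          Gc p ends o a₁ a₂ a₃ b) :
    MixChord p ends o a₁ a₂ a₃ b := by
  refine mixChord_of_remaining hp fun e he hc => ?_
  by_cases hco : CoincidenceClass p ends o a₁ a₂ b e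
  · obtain ⟨x, y, hxy, hx | hx, hm⟩ := hco
    · exact mixChord_of_halfChord_of_coincidence p ends o a₂ a₃ b hx hxy hm (hhalf e he ⟨x, y, hxy, Or.inl hx, hm⟩)
    · exact mixChord_of_halfChord_of_coincidence₂ p ends o a₂ a₃ b hx hxy hm (hhalf e he ⟨x, y, hxy, Or.inr hx, hm⟩)
  · exact hrest e he hc hco

end Narrowed

section NarrowedAll

variable (R : Type*) [Field R] [LinearOrder R] [IsStrictOrderedRing R]

/-- (HALF-CHORD) along every coincidence root edge, over all instances. -/
def HalfChordCoincidence_all : Prop :=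
  ∀ (V E : Type) [Fintype V] [DecidableEq V] [Fintype E] [DecidableEq E]
    (ends : E → Sym2 V) (p : E → R), IsProbVec p →
    ∀ o a₁ a₂ a₃ b : V, a₁ ≠ a₂ → a₁ ≠ a₃ → a₂ ≠ a₃ → o ≠ a₁ → o ≠ a₂ → o ≠ a₃ → o ≠ b →
      b ≠ a₁ → b ≠ a₂ → b ≠ a₃ →
      ∀ e ∈ Chord.rootEdges p ends a₁ a₂, CoincidenceClass p ends o a₁ a₂ b e →
        HalfChord p ends o a₁ a₂ a₃ b e

/-- (MIX-CHORD) along every root edge of neither the closed nor the coincidence class (the far end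
carries none of `o`, `b`, `a₃` in its weight-`1` cluster), over all instances. -/
def MixChordRest_all : Prop :=
  ∀ (V E : Type) [Fintype V] [DecidableEq V] [Fintype E] [DecidableEq E]
    (ends : E → Sym2 V) (p : E → R), IsProbVec p →
    ∀ o a₁ a₂ a₃ b : V, a₁ ≠ a₂ → a₁ ≠ a₃ → a₂ ≠ a₃ → o ≠ a₁ → o ≠ a₂ → o ≠ a₃ → o ≠ b →
      b ≠ a₁ → b ≠ a₂ → b ≠ a₃ →
      ∀ e ∈ Chord.rootEdges p ends a₁ a₂, ¬ ClosedClass p ends a₁ a₂ a₃ e →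
        ¬ CoincidenceClass p ends o a₁ a₂ b e →
        p e * Gc (Function.update p e 1) ends o a₁ a₂ a₃ b +
          (1 - p e) * (shrink p ends a₁ a₂ a₃ e * Gc (Function.update p e 0) ends o a₁ a₂ a₃ b) ≤
            Gc p ends o a₁ a₂ a₃ b

/-- **The crux from (HALF-CHORD) on the coincidence root edges and (MIX-CHORD) on the rest.** -/
theorem HCov_all_of_halfChord_of_rest (h₁ : HalfChordCoincidence_all R) (h₂ : MixChordRest_all R) :
    HCov_all R :=
  HCov_all_of_mixChord_all R fun V E _ _ _ _ ends p hp o a₁ a₂ a₃ b h12 h13 h23 ho1 ho2 ho3 hob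
    hb1 hb2 hb3 =>
      mixChord_of_halfChord_of_rest hp
        (h₁ V E ends p hp o a₁ a₂ a₃ b h12 h13 h23 ho1 ho2 ho3 hob hb1 hb2 hb3)
        (h₂ V E ends p hp o a₁ a₂ a₃ b h12 h13 h23 ho1 ho2 ho3 hob hb1 hb2 hb3)

end NarrowedAll

end Mix

end Summit.Ventures.PercRepro2
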